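import Summits.CriticalPhenomena.CardyFormulaZ2.Theorems.CardyBoundaryCoulombGasBoundaryDefectGaussianRS17ConfigsNonemptyPart13
import Summits.CriticalPhenomena.CardyFormulaZ2.Theorems.CardyBoundaryCoulombGasBoundaryDefectGaussianRS17ConfigsNonemptyPart2

/-!
# Stub `s17_eventually_configsNonempty` of the D2 completion (line
# `rainbow-monomials-in-excursion-kernels`, crux `BoundaryDefectGaussianR`,
# stmt-CriticalPhenomena-14132) — Part 14: the registered stub, eventually along the mesh sequence

**Theorem `s17_eventually_configsNonempty`** (registered stub P1 of the D2 completion skeleton,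
verbatim). Along a mesh sequence `δ_n → 0⁺`, for the lattice approximations `V_n` of a rectilinear
Jordan domain, EVENTUALLY: for every configuration `p` of `k` insertion points with leg numbers `L`
(sink `p j`, `L j = Σ_{i ≠ j} L i`) whose leg-insertion datum is admissible on `V_n`, flat at radius
`r / δ_n` and `r / δ_n`-separated, the jump collar has a height configuration.

Proof: eventually the insertion points are flat at lattice radius `sinkLegs + (9 L j + 20)`
(`ec_eventually_flat_radius`, Part 48: the sink carries `L j` legs whatever `p` is) and every
boundary vertex of `V_n` carries a chart of sup-radius `2 L j + 8` (`bc_eventually_chart`, Part 2);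
then Part 13 (`configsNonempty_of_flat_chart`) applies, uniformly in `p`. All [folklore].
-/

noncomputable section

open Filter Topology
open Literature.Probability.RandomPlanarGeometry
open Literature.Probability.LatticeModels Literature.Probability.LatticeModels.CollarLegModel

namespace Summit.CriticalPhenomena.CardyFormulaZ2.Cruxes.BoundaryDefectGaussianR.RainbowMonomialsInExcursionKernels

/-- **Eventual existence of a height configuration** (the content of the registered stub). [folklore] -/
theorem eventually_configsNonempty (k : ℕ) (L : Fin k → ℕ) (j : Fin k)
    (hL : L j = ∑ i ∈ Finset.univ.erase j, L i) (D : JordanDomain)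
    (hrect : ∃ S : Finset (ℂ × ℂ), (∀ q ∈ S, q.1.re = q.2.re ∨ q.1.im = q.2.im) ∧
      frontier D.carrier ⊆ ⋃ q ∈ S, segment ℝ q.1 q.2)
    (r : ℝ) (hr : 0 < r) (δ : ℕ → ℝ) (hδ : ∀ n, 0 < δ n) (hδ0 : Tendsto δ atTop (𝓝 0))
    (V : ℕ → Finset (ℤ × ℤ))
    (hV : ∀ n, ∀ v : ℤ × ℤ, v ∈ V n ↔
      ((v.1 : ℂ) * ((δ n : ℝ) : ℂ) + (v.2 : ℂ) * ((δ n : ℝ) : ℂ) * Complex.I) ∈ closure D.carrier) :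
    ∀ᶠ n in atTop, ∀ (p : Fin k → ℤ × ℤ), Function.Injective p →
      LegInsertionData.IsAdmissible (⟨(Finset.univ.erase j).image p,
        fun v ↦ ∑ b ∈ (Finset.univ.erase j).filter (fun b ↦ p b = v), L b, p j⟩ : LegInsertionData) (V n) →
      (∀ i', ∃ d : ℤ × ℤ, (d = (1, 0) ∨ d = (-1, 0) ∨ d = (0, 1) ∨ d = (0, -1)) ∧
        ∀ v : ℤ × ℤ, ((((v.1 - (p i').1) ^ 2 + (v.2 - (p i').2) ^ 2 : ℤ) : ℝ)) ≤ (r / δ n) ^ 2 →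
          (v ∈ V n ↔ 0 ≤ (v.1 - (p i').1) * d.1 + (v.2 - (p i').2) * d.2)) →
      (∀ i₁ i₂ : Fin k, i₁ ≠ i₂ →
        (r / δ n) ^ 2 ≤ (((((p i₁).1 - (p i₂).1) ^ 2 + ((p i₁).2 - (p i₂).2) ^ 2 : ℤ) : ℝ))) →
      ((LegInsertionData.model (⟨(Finset.univ.erase j).image p,
        fun v ↦ ∑ b ∈ (Finset.univ.erase j).filter (fun b ↦ p b = v), L b, p j⟩ : LegInsertionData)
        (V n)).configs).Nonempty := by
  have hflat := ec_eventually_flat_radius k L j hL r hr δ hδ hδ0 V (9 * (L j : ℤ) + 20)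
  have hchart := bc_eventually_chart D hrect δ hδ hδ0 V hV (2 * L j + 8)
  filter_upwards [hflat, hchart] with n hfl hch p _ hadm hFLAT _
  -- the sink carries `L j` legs, whatever `p` is
  have hsl : (⟨(Finset.univ.erase j).image p,
      fun v ↦ ∑ b ∈ (Finset.univ.erase j).filter (fun b ↦ p b = v), L b, p j⟩ :
        LegInsertionData).sinkLegs = L j := by
    rw [hL]
    exact Finset.sum_fiberwise_of_maps_to (fun b hb => Finset.mem_image_of_mem p hb) _
  refine configsNonempty_of_flat_chart _ (V n) hadm ?_ ?_
  · rw [hsl]; exact hch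
  · have h := hfl p hFLAT
    rw [hsl] at h ⊢
    exact h

/-! ### The registered stub -/

/-- **P1 of the D2 completion skeleton (registered stub `s17_eventually_configsNonempty` of
stmt-CriticalPhenomena-14132)**: eventually along the mesh sequence, the jump collar of every
admissible, flat, separated leg-insertion datum on the lattice approximation has a height
configuration. [folklore] -/
theorem s17_eventually_configsNonempty : ∀ (k : ℕ) (L : Fin k → ℕ) (j : Fin k), L j = ∑ i ∈ Finset.univ.erase j, L i → ∀ (D : Literature.Probability.RandomPlanarGeometry.JordanDomain), (∃ S : Finset (ℂ × ℂ), (∀ q ∈ S, q.1.re = q.2.re ∨ q.1.im = q.2.im) ∧ frontier D.carrier ⊆ ⋃ q ∈ S, segment ℝ q.1 q.2) → ∀ (r : ℝ), 0 < r → ∀ (δ : ℕ → ℝ), (∀ n, 0 < δ n) → Filter.Tendsto δ Filter.atTop (nhds 0) → ∀ (V : ℕ → Finset (ℤ × ℤ)), (∀ n, ∀ v : ℤ × ℤ, v ∈ V n ↔ (((v).1 : ℂ) * ((δ n : ℝ) : ℂ) + ((v).2 : ℂ) * ((δ n : ℝ) : ℂ) * Complex.I) ∈ closure D.carrier) → ∀ᶠ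 n in Filter.atTop, ∀ (p : Fin k → ℤ × ℤ), Function.Injective p → Literature.Probability.LatticeModels.CollarLegModel.LegInsertionData.IsAdmissible (⟨(Finset.univ.erase j).image (p), fun v ↦ ∑ b ∈ (Finset.univ.erase j).filter (fun b ↦ (p) b = v), L b, (p) j⟩ : Literature.Probability.LatticeModels.CollarLegModel.LegInsertionData) (V n) → (∀ i', (∃ d : ℤ × ℤ, (d = (1, 0) ∨ d = (-1, 0) ∨ d = (0, 1) ∨ d = (0, -1)) ∧ ∀ v : ℤ × ℤ, (((((v).1 - (p i').1) ^ 2 + ((v).2 - (p i').2) ^ 2 : ℤ) : ℝ)) ≤ (r / δ n) ^ 2 → (v ∈ V n ↔ 0 ≤ (v.1 - (p i').1) * d.1 + (v.2 - (p i').2) * d.2))) → (∀ i₁ i₂ : Fin k, i₁ ≠ i₂ → (r / δ n) ^ 2 ≤ ((((((p) i₁).1 - ((p) i₂).1) ^ 2 + (((p) i₁).2 - ((p) i₂).2) ^ 2 : ℤ) : ℝ))) → ((Literature.Probability.LatticeModels.CollarLegModel.LegInsertionData.model (⟨(Finset.univ.erase j).image (p), fun v ↦ ∑ b ∈ (Finset.univ.erase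 j).filter (fun b ↦ (p) b = v), L b, (p) j⟩ : Literature.Probability.LatticeModels.CollarLegModel.LegInsertionData) (V n)).configs).Nonempty :=
  fun k L j hL D hrect r hr δ hδ hδ0 V hV => eventually_configsNonempty k L j hL D hrect r hr δ hδ hδ0 V hV

end Summit.CriticalPhenomena.CardyFormulaZ2.Cruxes.BoundaryDefectGaussianR.RainbowMonomialsInExcursionKernels

end
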